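import Summits.QuantumFields.YangMills.Theorems.BalabanUVNodesN06Proj349AtPinsPhysRCPar

/-!
# BalabanUVNodes ∕ N06 ([B9], `Dag.B9_main`) — R1 J-TWIN (KD‴ LEGS): PRINT's (3.49) MAJORANT FOR THE RENORMALISATION PROJECTION `P` FROM THEOREM 3.7's WALK PRODUCT AND
# THE (3.48) DISPLAY (rows 15∕16), RATE-EXPOSED, SITE-TRANSPORTER-PARAMETRIC, ALONG A SUB-FAMILY `f : J → MemberY …` — the J-twin of
# ✓`…N06Proj349AtPinsPhysRCPar.proj349Maj_of_t37_display348_rateR_ge_par` (consumer «KD‴» l.248: its output IS the tainted row `h49` of every leg)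

Track A of `YM-PLAN.md` (cell `pub-ymgap`, HUMAN RULING D-0062), node **N06** = [Balaban1985BackgroundPropagators]; IR-N06-SECTION-2 road **R1** («J-twin of the
producer cone», ★★★ director-ym №524 (3): authorised in principle, STAGED, sibling files only), `R1-JTWIN-SPEC.md` rule (R)′ (dag-n06-d, 2026-08-31): re-key EXACTLY
the section-tainted ∀-member rows along `f`, keep data ∕ pins ∕ laws ∕ section-free rows member-wide, tainted conclusions along `f` ((R).3′).
Seat `pub-ymgap-dag-n06-d` g30 — own-producer twins under «KD‴».  THIS is the twin through which rows 15∕16 (`h348`) enter the cone: under R1 the display `h348` is a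
theorem on `J := SCMemberY` only (dag-n06-j ✓`B9Thm32KnitRows1516ThresholdsY`), so the (3.49) majorant comes out J-keyed and taints every downstream leg.

WHAT.  `proj349Maj_of_t37_display348_rateR_ge_par_J` = the parent's theorem with `{J : Type} (f : J → MemberY θ.d₆ θ.ℓ₆ θ.hd' θ.hL' θ.b₀ θ.b₁ Mstar)` added after the `H` binder and
* TAINTED ROW OF THIS TWIN: `h348` — the (3.48) block-convergence display `Conv348Blk (oneCubeOps39YF θ Mstar 𝔏 bI x) B₁ δ₁ U` (rows 15∕16), re-keyed `∀ x : MemberY … ↦ ∀ j : J`,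
  read at `f j`;
* LEFT member-wide: Theorem 3.7's walk product `t37` and its (3.42) consequences (the parent's ✓`left_right342_of_t37_pairM_ofR_closed_par`, section-free, READ BY NAME —
  not restated), the letters `𝔏 𝔬 rd`, the pins ∕ laws `hparS hGp haK hlawP hlev hβ1 hnbr hblkS hblkYS hGpS hDS hbI0`, the per-member threshold rule `hthr`, all x-free numerics;
* conclusion `∃ M a, 0 < M ∧ 0 < a ∧ ∀ j : J, M ≤ (geo9Y (f j)).M → … Proj349Maj … CP θ₉` along `f`.
PROOF: the parent's text by generator (`mkJ.py` over the tree bytes) with ONE hand edit: the parent's per-member call of ✓`…N06Proj349AtPinsPhysR.blk348_of_display348_rateR`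
(which takes the `h348` FAMILY and then the member) is replaced by that lemma's own three-line body at `f j` (`h348 j …` → n06-i's ✓`blk348At_of_hasMajorant`); x-free
∃-witnesses; `fun x ↦ fun j`, `x ↦ f j`; nothing else re-derived.
HONEST FRAMING.  Bookkeeping over landed objects; Theorem 3.7 and the (3.48) display are HYPOTHESES; nothing of [B9] ∕ [4] asserted; COUNT-NEUTRAL (`--supports
stmt-QuantumFields-27239 --as helper`); N06 NOT discharged; K1 NOT closed; under R1 the inner-corner question stays DISPLAYED at the K1 face ∕ NODE O join by (α5); nothing
continuum ∕ OS ∕ mass gap ∕ Clay.  0 `def`, 0 `sorry`.  NEW file; the parent untouched.  The member-wide parent is the instance `J := MemberY …`, `f := id`; ORPHAN by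
design until «KD‴»ᴶ lands (honest).
[cite: Balaban1985BackgroundPropagators, Thm 3.7 (3.42) p.397, (3.48)–(3.49) p.398, Thm 3.9 p.404; Balaban1984PropagatorsII, Lemma 2.1 (2.60)–(2.61) p.234]
-/

noncomputable section

namespace Summit.QuantumFields.YangMills.BalabanUVNodes.N06Proj349AtPinsPhysRCParJ

open Literature.MathematicalPhysics.QuantumFieldTheory.Balaban1983to89
open Literature.MathematicalPhysics.QuantumFieldTheory.Balaban1983to89.Node00
open Literature.MathematicalPhysics.QuantumFieldTheory.Balaban1983to89.B6KLevelCensusIndexV1 (KIdx)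
open Literature.MathematicalPhysics.QuantumFieldTheory.Balaban1983to89.B6GlobalChartV1 (blkV1)
open Literature.MathematicalPhysics.QuantumFieldTheory.Balaban1983to89.B6Ineq2142KLevelV1 (lvl β)
open Literature.MathematicalPhysics.QuantumFieldTheory.Balaban1983to89.B9Thm34Ext (toB6)
open Literature.MathematicalPhysics.QuantumFieldTheory.Balaban1983to89.B9Thm37Whole (Ops Conv342)
open Literature.MathematicalPhysics.QuantumFieldTheory.Balaban1983to89.B9Cor38Whole (WalkReading)
open Literature.MathematicalPhysics.QuantumFieldTheory.Balaban1983to89.B9Thm39WholeBlk (Conv348Blk)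
open Literature.MathematicalPhysics.QuantumFieldTheory.Balaban1983to89.B9Thm39OneCubeReadingAtLettersY (oneCubeOps39YF)
open Literature.MathematicalPhysics.QuantumFieldTheory.Balaban1983to89.B9Thm39ReadingAtLetters (basis39 κ39)
open Literature.MathematicalPhysics.QuantumFieldTheory.Balaban1983to89.B9Thm39ReadingCoords (cR39)
open Literature.MathematicalPhysics.QuantumFieldTheory.Balaban1983to89.B9CoReadingCoords (blkBK)
open Literature.MathematicalPhysics.QuantumFieldTheory.Balaban1983to89.B9CoReadingCoordsS (XSK blkSK sIK GcoS DcoS)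
open Literature.MathematicalPhysics.QuantumFieldTheory.Balaban1983to89.B9Ineq349SiteReading (fineEntryS)
open Literature.MathematicalPhysics.QuantumFieldTheory.Balaban1983to89.B9Ineq349SiteComposite (lenB distB lenB_pos Left342At Right342At Blk348At)
open Literature.MathematicalPhysics.QuantumFieldTheory.Balaban1983to89.B9Ineq349SiteFromBlocks (geo9Y_M_eq)
open Literature.MathematicalPhysics.QuantumFieldTheory.Balaban1983to89.B9Ineq349SiteFromConv342 (left342At_of_hasMajorants contractive_of_mem)
open Literature.MathematicalPhysics.QuantumFieldTheory.Balaban1983to89.B9Ineq349SiteFromConv348 (blk348At_of_hasMajorant)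
open Literature.MathematicalPhysics.QuantumFieldTheory.Balaban1983to89.B9Ineq349SiteAdjoint (right342At_of_left342At)
open Literature.MathematicalPhysics.QuantumFieldTheory.Balaban1983to89.B9Thm311ReadingCoords (IsSymmTr)
open Literature.MathematicalPhysics.QuantumFieldTheory.Balaban1983to89.B9RWSumsDefinitePins (PinPrims)
open Literature.MathematicalPhysics.QuantumFieldTheory.Balaban1983to89.B9RWSumsDefinitePinsPair (PairPrims)
open Literature.MathematicalPhysics.QuantumFieldTheory.Balaban1983to89.B9RWSumsDefinitePinsPairM (MixedPrims E37YPairM)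
open Literature.MathematicalPhysics.QuantumFieldTheory.Balaban1983to89.B9RWSums347DefiniteFaces (exp261)
open Literature.MathematicalPhysics.QuantumFieldTheory.Balaban1983to89.B7Prop2SpecialUnitary (specialUnitaryUnits specialUnitaryUnits_le_unitaryUnits)
open Literature.MathematicalPhysics.QuantumFieldTheory.Balaban1983to89.B9PinMembersKLevelV1 (MemberY geo9Y bg9Y)
open Literature.MathematicalPhysics.QuantumFieldTheory.Balaban1983to89.B9BackgroundsKLevelV1R (RegFamY bg9YR MemOfFam mem_of_reg335R)
open Literature.MathematicalPhysics.QuantumFieldTheory.Balaban1983to89.B9RWSumsReadsNbr (nbr)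
open Literature.MathematicalPhysics.QuantumFieldTheory.Balaban1983to89.B9PerturbationMajorantAlgebra (Proj349Maj)
open Literature.MathematicalPhysics.QuantumFieldTheory.Balaban1983to89.B9PerturbationMajorantsAtLetters (PcoK)
open Literature.MathematicalPhysics.QuantumFieldTheory.Balaban1983to89.Node00.OpsYSectDCoords (DvcoKH DvscoKH)
open Literature.MathematicalPhysics.QuantumFieldTheory.Balaban1983to89.B9Proj349MajFromBlocks (proj349Maj_of_allBlocks)
open Literature.MathematicalPhysics.QuantumFieldTheory.Balaban1983to89.B9SitePinBlockCounts (exists_card_nearBlocks_le)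
open scoped Matrix.Norms.L2Operator
open Summit.QuantumFields.YangMills.BalabanUVNodes.N06Proj349AtPinsPhysR (blk348_of_display348_rateR)
open Summit.QuantumFields.YangMills.BalabanUVNodes.N06Proj349AtPinsPhysRCPar (left_right342_of_t37_pairM_ofR_closed_par)
open Literature.MathematicalPhysics.QuantumFieldTheory.Balaban1983to89.B9WalkLettersCoordsS (nearBlkCntY walkCntM₀Y nearBlkCntY_nonneg card_nearBlocks_le)
open Literature.MathematicalPhysics.QuantumFieldTheory.Balaban1983to89.B9Thm39ReadingCoords (coordBound39 basisBound39)
open Literature.MathematicalPhysics.QuantumFieldTheory.Balaban1983to89.B6RandomWalk (hasMajorant_mono)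
open Literature.MathematicalPhysics.QuantumFieldTheory.Balaban1983to89.B6RandomWalkHom (hasMajorantHom_mono)
open Literature.MathematicalPhysics.QuantumFieldTheory.Balaban1983to89.B9GeoLemma21KLevelV1 (geo9Y_len_pos)
open Summit.QuantumFields.YangMills.BalabanUVNodes.N06Proj349AtPinsPhysRC (proj349Maj_mono_const)
open Literature.MathematicalPhysics.QuantumFieldTheory.Balaban1983to89.B9Thm311AdjointPairs (GpY_isSymmTr)

variable {N : ℕ} {κ : Type} [Fintype κ] [DecidableEq κ]

/-- ★★ **THE (3.49) MAJORANT SCHEMA AT AN EXPLICIT RATE, AT THE TWO TRANSPORTER PARAMETERS** (module docstring): `proj349Maj_of_t37_display348_rateR_ge` with the pins reading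
`(parH x, GpY _ (parA x))` and the two transporter facts displayed as `hlawP` above `(MK, aK)`.
[cite: Balaban1985BackgroundPropagators, (3.49) p.399, Thm 3.7 p.408, (3.48) p.398, (3.40) p.397, (3.19) p.393, (3.35)–(3.36) p.396; Balaban1984PropagatorsII, (2.59)–(2.61) pp.233–234] -/
theorem proj349Maj_of_t37_display348_rateR_ge_par_J (θ : Stage3Params) (Mstar : ℕ) {R₁ R₂ : RegFamY θ.d₆ θ.ℓ₆ θ.hd' θ.hL' θ.b₀ θ.b₁ Mstar (Matrix (Fin N) (Fin N) ℂ)}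
    (hG : MemOfFam (specialUnitaryUnits (Fin N)) R₁) (𝔏 : LettersY N θ Mstar)
    -- [CASCADE-K] TWO transporter roles (dag-n06-c FLAG K1-PAR): `parH` = the HÖLDER-READING transporter of the letters ((3.40), shortest contours), `parA` = the AVERAGING transporter inside `G′` ((3.19)∕(3.21))
    (parA parH : ∀ x : MemberY θ.d₆ θ.ℓ₆ θ.hd' θ.hL' θ.b₀ θ.b₁ Mstar, SiteParY (Matrix (Fin N) (Fin N) ℂ) x.toKIdx)
    (hparS : ∀ x : MemberY θ.d₆ θ.ℓ₆ θ.hd' θ.hL' θ.b₀ θ.b₁ Mstar, (𝔏 x).parS = parH x) (hGp : ∀ x : MemberY θ.d₆ θ.ℓ₆ θ.hd' θ.hL' θ.b₀ θ.b₁ Mstar, (𝔏 x).Gp = GpY x.toKIdx (parA x))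
    [∀ x : MemberY θ.d₆ θ.ℓ₆ θ.hd' θ.hL' θ.b₀ θ.b₁ Mstar, Fintype (geo9Y x).Site] [∀ x : MemberY θ.d₆ θ.ℓ₆ θ.hd' θ.hL' θ.b₀ θ.b₁ Mstar, DecidableEq (geo9Y x).Site]
    (b : Module.Basis κ ℝ (Matrix (Fin N) (Fin N) ℂ)) (hcb : 0 < cR39 b) {c35 : ℝ} (hc : 0 < c35)
    -- [CASCADE-K K2] the transporter LAWS on the regime above a threshold: `parH`'s legs unitary, `Δ′_a(U; parA x)` trace-symmetric (today both at `parSymY`: `parSymY_mem`, `symm0_parSymY`; knit: `parH := parSymY`, `parA := parKnitY` by dag-n06-l's `symm0_parKnitY` on (3.35))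
    {MK aK : ℝ} (haK : 0 < aK)
    (hlawP : ∀ x : MemberY θ.d₆ θ.ℓ₆ θ.hd' θ.hL' θ.b₀ θ.b₁ Mstar, MK ≤ (geo9Y x).M → ∀ α₀ : ℝ, 0 < α₀ → (geo9Y x).M * α₀ ≤ aK → ∀ U : (bg9YR (Matrix (Fin N) (Fin N) ℂ) (specialUnitaryUnits (Fin N)) R₁ R₂ x).Cfg, (bg9YR (Matrix (Fin N) (Fin N) ℂ) (specialUnitaryUnits (Fin N)) R₁ R₂ x).Reg335 c35 α₀ U →
      (∀ z w : SiteY x.toKIdx, parH x U z w ∈ B7Prop2Explicit.unitaryUnits (Matrix (Fin N) (Fin N) ℂ)) ∧ IsSymmTr (fun _ => (1 : ℝ)) (deltaPrimeAY x.toKIdx (parA x) U))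
    {bI : ∀ x : MemberY θ.d₆ θ.ℓ₆ θ.hd' θ.hL' θ.b₀ θ.b₁ Mstar, FBondY x.toKIdx → IBondY x.toKIdx}
    (hbI0 : ∀ (x : MemberY θ.d₆ θ.ℓ₆ θ.hd' θ.hL' θ.b₀ θ.b₁ Mstar) (f : FBondY x.toKIdx), bI x f = bI x ⟨f.src, 0⟩)
    (hlev : ∀ (x : MemberY θ.d₆ θ.ℓ₆ θ.hd' θ.hL' θ.b₀ θ.b₁ Mstar) (f : FBondY x.toKIdx), lvl x.hN x.D x.hk (bI x f) = (blkV1 x.hN x.D f).1.1)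
    (hβ1 : ∀ (x : MemberY θ.d₆ θ.ℓ₆ θ.hd' θ.hL' θ.b₀ θ.b₁ Mstar) (f : FBondY x.toKIdx),
      (B6Geom246MultiLevelTorus.geomT x.D).dist (β x.hN x.D x.hk (bI x f)) (blkV1 x.hN x.D f) ≤ 1)
    {mN : ℕ} (hnbr : ∀ (x : MemberY θ.d₆ θ.ℓ₆ θ.hd' θ.hL' θ.b₀ θ.b₁ Mstar) (y : (geo9Y x).Site), (nbr (geo9Y x) 2 y).card ≤ mN)
    -- row 18: Theorem 3.7's leaf on the `PairM` E-letter at the site pins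
    {ι : MemberY θ.d₆ θ.ℓ₆ θ.hd' θ.hL' θ.b₀ θ.b₁ Mstar → Type}
    (𝔬 : ∀ x : MemberY θ.d₆ θ.ℓ₆ θ.hd' θ.hL' θ.b₀ θ.b₁ Mstar, Ops (geo9Y x) (bg9YR (Matrix (Fin N) (Fin N) ℂ) (specialUnitaryUnits (Fin N)) R₁ R₂ x)
      (XSK κ x.toKIdx) (XSK κ x.toKIdx) (ι x))
    (rd : ∀ x : MemberY θ.d₆ θ.ℓ₆ θ.hd' θ.hL' θ.b₀ θ.b₁ Mstar, WalkReading (geo9Y x) (bg9YR (Matrix (Fin N) (Fin N) ℂ) (specialUnitaryUnits (Fin N)) R₁ R₂ x)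
      (XSK κ x.toKIdx) (ι x))
    (H : MemberY θ.d₆ θ.ℓ₆ θ.hd' θ.hL' θ.b₀ θ.b₁ Mstar → Prop) {J : Type} (f : J → MemberY θ.d₆ θ.ℓ₆ θ.hd' θ.hL' θ.b₀ θ.b₁ Mstar) {m mN' : ℕ} {Cev NQ : ℝ} {p q : PinPrims} (hp : p.OK) {p3 q3 : PairPrims}
    {pM qM : MixedPrims}
    {K : ∀ x : MemberY θ.d₆ θ.ℓ₆ θ.hd' θ.hL' θ.b₀ θ.b₁ Mstar, B9.KernelFamily (geo9Y x) (bg9YR (Matrix (Fin N) (Fin N) ℂ) (specialUnitaryUnits (Fin N)) R₁ R₂ x)}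
    (t37 : B9.Thm37Printed c35 (fun x : MemberY θ.d₆ θ.ℓ₆ θ.hd' θ.hL' θ.b₀ θ.b₁ Mstar => geo9Y x)
      (bg9YR (Matrix (Fin N) (Fin N) ℂ) (specialUnitaryUnits (Fin N)) R₁ R₂)
      (fun x => E37YPairM (bg := bg9YR (Matrix (Fin N) (Fin N) ℂ) (specialUnitaryUnits (Fin N)) R₁ R₂) m mN' Cev NQ p q p3 q3 pM qM (𝔬 x) (rd x) (H x) (K x)))
    (hblkS : ∀ x : MemberY θ.d₆ θ.ℓ₆ θ.hd' θ.hL' θ.b₀ θ.b₁ Mstar, (𝔬 x).blk = blkSK x.toKIdx (sIK x.toKIdx (bI x)))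
    (hblkYS : ∀ x : MemberY θ.d₆ θ.ℓ₆ θ.hd' θ.hL' θ.b₀ θ.b₁ Mstar, (𝔬 x).blkY = blkSK x.toKIdx (sIK x.toKIdx (bI x)))
    (hGpS : ∀ (x : MemberY θ.d₆ θ.ℓ₆ θ.hd' θ.hL' θ.b₀ θ.b₁ Mstar) (U : (bg9YR (Matrix (Fin N) (Fin N) ℂ) (specialUnitaryUnits (Fin N)) R₁ R₂ x).Cfg),
      (𝔬 x).Gp U = GcoS x.toKIdx b (bg9YR (Matrix (Fin N) (Fin N) ℂ) (specialUnitaryUnits (Fin N)) R₁ R₂ x) (fun U => U) (𝔏 x).Gp U)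
    (hDS : ∀ (x : MemberY θ.d₆ θ.ℓ₆ θ.hd' θ.hL' θ.b₀ θ.b₁ Mstar) (U : (bg9YR (Matrix (Fin N) (Fin N) ℂ) (specialUnitaryUnits (Fin N)) R₁ R₂ x).Cfg),
      (𝔬 x).D U = DcoS x.toKIdx b (bg9YR (Matrix (Fin N) (Fin N) ℂ) (specialUnitaryUnits (Fin N)) R₁ R₂ x) (fun U => U) U)
    -- rows 15–16: the one display `(3.48)⁻¹` on the faithful one-cube letters over `𝔏`
    {B₁ δ₁ a₁ M₁ : ℝ} (hB : 0 ≤ B₁) (hδ : 0 < δ₁) (ha₁ : 0 < a₁)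
    (h348 : ∀ j : J, M₁ ≤ (geo9Y (f j)).M → ∀ α₀ : ℝ, 0 < α₀ → c35 * (geo9Y (f j)).M * α₀ ≤ a₁ →
      ∀ U : (bg9YR (Matrix (Fin N) (Fin N) ℂ) (specialUnitaryUnits (Fin N)) R₁ R₂ (f j)).Cfg,
        (bg9YR (Matrix (Fin N) (Fin N) ℂ) (specialUnitaryUnits (Fin N)) R₁ R₂ (f j)).Reg335 c35 α₀ U → Conv348Blk (oneCubeOps39YF θ Mstar 𝔏 bI (f j)) B₁ δ₁ U)
    -- the (3.49) threshold fact AT THE RATE θ for the rate pair ((1−2α)δ₀, δ₁)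
    (θ₉ Cg M₃ : ℝ) (hθ₉ : 0 ≤ θ₉) (hCg : 0 ≤ Cg)
    (hthr : ∀ i : KIdx θ.d₆ θ.ℓ₆ θ.hd' θ.hL' θ.b₀ θ.b₁, M₃ ≤ ((θ.ℓ₆ : ℝ) + 1) * i.Mh →
      ∀ (parS : SiteParY (Matrix (Fin N) (Fin N) ℂ) i) (Gp : SiteOpY (Matrix (Fin N) (Fin N) ℂ) i) (U : CfgY (Matrix (Fin N) (Fin N) ℂ) i) (B₀ B₁' : ℝ),
        0 ≤ B₀ → 0 ≤ B₁' → Left342At i parS Gp U B₀ ((1 - 2 * p.α) * p.δ₀) → Right342At i parS Gp U B₀ ((1 - 2 * p.α) * p.δ₀) →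
        Blk348At i parS Gp U B₁' δ₁ →
          ∀ (n : Fin 4) (s s' : BlkY i), fineEntryS i (P349Y i parS Gp) U s s' n ≤
            B₀ * B₁' * B₀ * Cg * B9.pref4inv (lenB i s) n * lenB i s' ^ (-((θ.d₆ + 1 : ℕ) : ℝ)) * Real.exp (-(θ₉ * distB i s s')))
    -- the DISPLAYED constant letter with its one closed lower budget
    (CP : ℝ) (hCPge : ((θ.d₆ + 1 : ℕ) : ℝ) * (coordBound39 b * basisBound39 b * nearBlkCntY θ.d₆ θ.ℓ₆ θ.hd' θ.hL' θ.b₀ θ.b₁ Mstar *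
        ((max 1 (N : ℝ) * ((mN : ℝ) * p.C (exp261 (@geo9Y θ.d₆ θ.ℓ₆ θ.hd' θ.hL' θ.b₀ θ.b₁ Mstar) p.δ₀ p.α) * Real.exp (2 * ((1 - 2 * p.α) * p.δ₀)))) *
          (cR39 (basis39 (Matrix (Fin N) (Fin N) ℂ)) * Fintype.card (κ39 (Matrix (Fin N) (Fin N) ℂ)) * B₁ * Real.exp (2 * δ₁)) *
          (max 1 (N : ℝ) * ((mN : ℝ) * p.C (exp261 (@geo9Y θ.d₆ θ.ℓ₆ θ.hd' θ.hL' θ.b₀ θ.b₁ Mstar) p.δ₀ p.α) * Real.exp (2 * ((1 - 2 * p.α) * p.δ₀)))) * Cg) * Real.exp (2 * θ₉)) ≤ CP) :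
    ∃ M a : ℝ, 0 < M ∧ 0 < a ∧
      ∀ j : J, M ≤ (geo9Y (f j)).M → ∀ α₀ : ℝ, 0 < α₀ → (geo9Y (f j)).M * α₀ ≤ a →
        ∀ U : (bg9YR (Matrix (Fin N) (Fin N) ℂ) (specialUnitaryUnits (Fin N)) R₁ R₂ (f j)).Cfg,
          (bg9YR (Matrix (Fin N) (Fin N) ℂ) (specialUnitaryUnits (Fin N)) R₁ R₂ (f j)).Reg335 c35 α₀ U →
          Proj349Maj (g := geo9Y (f j)) (blkSK (f j).toKIdx (sIK (f j).toKIdx (bI (f j)))) (blkBK (f j).toKIdx (bI (f j)))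
            (PcoK (f j).toKIdx b (bg9YR (Matrix (Fin N) (Fin N) ℂ) (specialUnitaryUnits (Fin N)) R₁ R₂ (f j)) (fun U => U) (𝔏 (f j)).parS (𝔏 (f j)).Gp U)
            (DvcoKH (f j).toKIdx b (bg9YR (Matrix (Fin N) (Fin N) ℂ) (specialUnitaryUnits (Fin N)) R₁ R₂ (f j)) (fun U => U) U)
            (DvscoKH (f j).toKIdx b (bg9YR (Matrix (Fin N) (Fin N) ℂ) (specialUnitaryUnits (Fin N)) R₁ R₂ (f j)) (fun U => U) U) 1 (H (f j)) CP θ₉ := by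
  obtain ⟨M₂, a₀, hM₂, ha₀, h342⟩ :=
    left_right342_of_t37_pairM_ofR_closed_par θ Mstar hG 𝔏 parA parH hparS hGp b haK hlawP hlev hβ1 hnbr 𝔬 rd H hp t37 hblkS hblkYS hGpS hDS
  set B₀ : ℝ := (max 1 (N : ℝ) * ((mN : ℝ) * p.C (exp261 (@geo9Y θ.d₆ θ.ℓ₆ θ.hd' θ.hL' θ.b₀ θ.b₁ Mstar) p.δ₀ p.α) * Real.exp (2 * ((1 - 2 * p.α) * p.δ₀)))) with hB₀def
  have hB₀ : 0 ≤ B₀ := by have := p.C_nonneg hp (exp261 (@geo9Y θ.d₆ θ.ℓ₆ θ.hd' θ.hL' θ.b₀ θ.b₁ Mstar) p.δ₀ p.α); rw [hB₀def]; positivity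
  set ML : ℝ := walkCntM₀Y θ.d₆ θ.ℓ₆ θ.hd' θ.hL' θ.b₀ θ.b₁ Mstar with hMLdef
  have hN₁0 : 0 ≤ nearBlkCntY θ.d₆ θ.ℓ₆ θ.hd' θ.hL' θ.b₀ θ.b₁ Mstar := nearBlkCntY_nonneg
  set B₁' : ℝ := cR39 (basis39 (Matrix (Fin N) (Fin N) ℂ)) * Fintype.card (κ39 (Matrix (Fin N) (Fin N) ℂ)) * B₁ * Real.exp (2 * δ₁) with hB₁'
  have hB₁'0 : 0 ≤ B₁' := by
    rw [hB₁']; exact mul_nonneg (mul_nonneg (mul_nonneg (B9Thm39ReadingCoords.cR39_nonneg _) (Nat.cast_nonneg _)) hB) (Real.exp_nonneg _)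
  set C : ℝ := B₀ * B₁' * B₀ * Cg with hC
  have hC0 : 0 ≤ C := by rw [hC]; positivity
  have hcb' : 0 ≤ B9Thm39ReadingCoords.coordBound39 b := norm_nonneg _
  have hbb' : 0 ≤ B9Thm39ReadingCoords.basisBound39 b := Finset.sum_nonneg fun _ _ => norm_nonneg _
  refine ⟨max (max M₂ M₁) (max M₃ ML), min a₀ (a₁ / c35),
    lt_of_lt_of_le hM₂ ((le_max_left _ _).trans (le_max_left _ _)), lt_min ha₀ (div_pos ha₁ hc), fun j hM α₀ hα₀ hMa U hU => ?_⟩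
  have hM2 : M₂ ≤ (geo9Y (f j)).M := ((le_max_left _ _).trans (le_max_left _ _)).trans hM
  have hM1 : M₁ ≤ (geo9Y (f j)).M := ((le_max_right _ _).trans (le_max_left _ _)).trans hM
  have hM3 : M₃ ≤ (geo9Y (f j)).M := ((le_max_left _ _).trans (le_max_right _ _)).trans hM
  have hML : ML ≤ (geo9Y (f j)).M := ((le_max_right _ _).trans (le_max_right _ _)).trans hM
  obtain ⟨hL, hR⟩ := h342 (f j) hM2 α₀ hα₀ (hMa.trans (min_le_left _ _)) U hU
  have hBk : Blk348At (f j).toKIdx (𝔏 (f j)).parS (𝔏 (f j)).Gp U B₁' δ₁ := by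
    have hMa' : c35 * (geo9Y (f j)).M * α₀ ≤ a₁ := by
      rw [mul_assoc]
      calc c35 * ((geo9Y (f j)).M * α₀) ≤ c35 * (a₁ / c35) := mul_le_mul_of_nonneg_left (hMa.trans (min_le_right _ _)) hc.le
        _ = a₁ := mul_div_cancel₀ a₁ hc.ne'
    obtain ⟨T, hTL, hLT, hm⟩ := h348 j hM1 α₀ hα₀ hMa' U hU
    rw [hB₁']; exact blk348At_of_hasMajorant (f j) (𝔏 (f j)).parS (𝔏 (f j)).Gp U (hlev (f j)) (hβ1 (f j)) hB hδ.le T hTL hLT hm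
  have hM3' : M₃ ≤ ((θ.ℓ₆ : ℝ) + 1) * (f j).Mh := (geo9Y_M_eq (f j)) ▸ hM3
  have hP := hthr (f j).toKIdx hM3' (𝔏 (f j)).parS (𝔏 (f j)).Gp U B₀ B₁' hB₀ hB₁'0 hL hR hBk
  exact proj349Maj_mono_const (f j)
    (proj349Maj_of_allBlocks (G := specialUnitaryUnits (Fin N)) (f j) b hcb (𝔏 (f j)).parS (𝔏 (f j)).Gp U (hbI0 (f j)) (hlev (f j)) (hβ1 (f j)) hN₁0 (card_nearBlocks_le (f j) hML) hC0 hθ₉ hP 1 (H (f j)))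
    hCPge

end Summit.QuantumFields.YangMills.BalabanUVNodes.N06Proj349AtPinsPhysRCParJ

end
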